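import Literature.MathematicalPhysics.QuantumFieldTheory.Balaban1983to89.Node00.Record12CarriersB13Family
import Literature.MathematicalPhysics.QuantumFieldTheory.Balaban1983to89.B13Term214
import Literature.MathematicalPhysics.QuantumFieldTheory.Balaban1983to89.B13TermWalkDataOneTorus

/-!
# NODE 00 (YM-PLAN Track A) — STAGE 3′(X.B13), STOREY 2 OF THE TERM TOWER OF RECORD: THE H-TOWER KEYED ON NODE A's KERNEL FAMILY
# (`ResidB13K`, the (2.14) term OF RECORD `ResidB13K.T₃`, the layer of record `ResidB13K.layer : ResidB13 θ`, the walks junction's dictionary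
# DISCHARGED at it, the family ∕ Stage-12 currencies, and the relocated honesty lever)

NODE 00 DEFINER MODULE (seat `pub-ymgap-node00-def-B13`, generation 4, 2026-08-27; director-ym R141 (A) row «`Node00/CarriersB13.lean`, term tower; N10 s1 pin
half»; dag-n10-d g3's design remark «next contentful storey: the H-tower keyed on NODE A's kernel family»).  APPEND-ONLY: a NEW importing module;
`Node00/CarriersB13` (g0), `Node00/Record12CarriersB13` (g2), `Node00/Record12CarriersB13Family` (g3), `B13Term214`, `B13TermWalkData(OneTorus)` untouched and
CONSUMED BY NAME.
[Balaban1988RG2Cluster] = T. Bałaban, *Renormalization group approach to lattice gauge field theories. II. Cluster expansions*, Commun. Math. Phys.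
**116** (1988) 1–22; [Balaban1987RG1] = part I, Commun. Math. Phys. **109** (1987) 249–301; [13] = [Balaban1985BackgroundPropagators].

THE PIN.  g0's residual [B13] term layer `ResidB13 θ` carries the terms `T₃ Z (𝐃, P) φ` of `H(Z) = Σ_{(𝐃,P)} T₃` ((2.9) p. 14) as FREE DATA; the walks junction
`Summit…N10AtRecord11B13Walks.b13LeafOfRecord_of_located_walks` then asks, per term, for NODE A's kernel data `𝒦 Z t : B13TermWalkData.TermKernels` and THE
DICTIONARY `hT₃ : ‖lam.T₃ Z t φ‖ ≤ ‖B13Term214.term214 r (Z∖Z′₀) 𝐃 (core214 (σ ↦ (𝒦 Z t).A2 σ u) Γ (F214 |P| χ_{k,Y₀} χᶜ_{k,P} 𝐃 𝐕_k)) 0 0‖` together with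
the data `lZ lD Γm χY₀ χcP Pl Vr emb` and their laws `hlZ hlD hlin hχc hχ0 hχ1 hVr hrP`.  THIS STOREY MAKES THE TERM PRINT's (2.14) DISPLAY BY DEFINITION:
`ResidB13K θ` = every field of `ResidB13 θ` EXCEPT `T₃`, PLUS the (2.14) kernel-side data — [13]'s site torus `UT Nf` (`ν`, `Nf`), the kernels' configuration
argument space `E₃`, THE PER-TERM KERNEL FAMILY `𝒦 Z t : TermKernels {c with L := θ.ℓ₆+1} 4 (n+1) ν Nf E₃` (row bonds `Λ` of Z₀, extra columns `C₀`, the joint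
precision `A(σ,u) = C^{(k)}(Z₀,σ(Z))⁻¹`, the Γ-kernel `G(σ,u)` of `Γ_k(Z₀,σ(Z)) = C*Δ_k(σ(Z))CZ₀ᶜ(C^{(k)})^{1/2}(σ(Z))`, the real references and locations —
NODE A's object, nothing asserted), the configuration reading `uOf Z t φ : E₃` (p. 15 «U = U′U, U′ = exp iL⁻¹ηA′, and A′, J … are small»), the Cauchy radius `r`
of (2.14)'s contours, the row bonds `Y0l Z t` of χ_{k,Y₀} and `Pl Z t` of χᶜ_{k,P} ((2.3) p. 12), and the configuration `emb Z t φ B` with real fluctuation field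
`B` on the row bonds.  Then, for `lamK : ResidB13K θ` (all `def`s, print's displays):
* `rP := c.ε₁ ∕ ‖g‖` — the small-field threshold `ε₁∕g_k` of (2.3) ([I] (2.12): `g` = the running coupling of `B = g_k B′`);
* `chiY₀ Z t B := Π_{b ∈ Y0l Z t} χ(|B(b)| < rP)`, `chicP Z t B := Π_{b ∈ Pl Z t} χ(|B(b)| ≥ rP)` — (2.3)'s χ_{k,Y₀}, χᶜ_{k,P} ([I] (2.9) p. 266: χ_k = Πχ({|B′(b)| < ε₁}));
* `Gam Z t φ σ X := G(σ, uOf Z t φ)·X` — `Γ_k(Z₀,σ(Z))X` (p. 15, after (2.14));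
* `Vr Z t φ Y B := frame.V Y (emb Z t φ B)` — `𝐕_k(Y, B)` = g0's (1.41) potential OF RECORD at the configuration with fluctuation `B`;
* `lZ Z t := (Z ∖ Z′₀(t)).toList` (`TreeLengthTorusTransfer.tclosure` of `B13Lemma3TorusTerms.Z0`), `lD t := 𝐃.toList` — the two parameter lists of (2.14);
* `core Z t φ := core214 (σ ↦ A(σ, uOf Z t φ)) (Gam Z t φ) (F214 |P| (chiY₀ Z t) (chicP Z t) 𝐃 (Vr Z t φ))` — the X-integral Ψ(σ,τ), lines 2–4 of (2.14);
* **`T₃ Z t φ := term214 r (lZ Z t) (lD t) (core Z t φ) 0 0`** — THE (2.14) TERM OF RECORD (base points σ = 0 off Z∖Z′₀ by (2.8), τ integrated by (2.1));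
* **`layer : ResidB13 θ := { frame with T₃ := T₃ }`** — THE [B13] LAYER OF RECORD KEYED ON THE KERNEL FAMILY (`frame` = the T₃-free fields with `T₃ := 0`,
  auxiliary: only its T₃-independent functions `V ∕ Vp ∕ Vpp ∕ Q ∕ rd` are read).  EVERY g0 ∕ g2 ∕ g3 object — `WtOfRecord θ lamK.layer`, `c13OfRecord`,
  `B13LeafOfRecord`, `withB13OfRecord`, `Stage11Params.pinB13`, `Stage12Params.pinB13`, `ResidB13Fam`, `B13FamLeafOfRecord(₁₂)` — applies to `lamK.layer` BY NAME.
RESIDUAL (displayed, NO law): everything of `ResidB13` but `T₃`, and the kernel-side data above.  NOT PINNED here (they stay the junction's located inputs, said):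
the admissibility of `r` (`0 < r ≤ e^{κ₁} − 1`), `|Pl Z t| = |P|` (`hPcard`), the size `‖uOf‖ ≤ α` (`huα`), the record's bond ∕ cube maps and the consistency of `emb`
with `Bv` (`ιb cube hBv hBv0 hQsupp hfibc`), the support clause `hχsupp`, separate holomorphy `hΨσ hΨτ`, NODE A's structural inputs `hAs hΓq`, the fibre bounds, THE
RUNG `TermWalks (𝒦 Z t) q` with its letters, and the numerics; `Dfam := 𝐃 = t.1` and `|P| := t.2.card` ARE pinned (print: Σ_{Y∈𝐃}, (−1)^{|P|}).  A later storey may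
pin `𝒦` itself to the blocks of ONE operator `C*Δ_k(σ)C` (dag-n10-c's conditioning reading (2.5)–(2.6)) or to def-T's `TermTowerOfRecord`; nothing here anticipates it.

WHAT IS PROVED (kernel bookkeeping, 0 sorry).  §1 `ResidB13.withKernels` (attach kernel data to a g0 layer, dropping its `T₃`) and the faces of the layer of
record: `layer_T₃` (= the (2.14) term, `rfl`), `layer_n ∕ _k ∕ _m₃ ∕ _g ∕ _c ∕ _sp1 ∕ _sp2 ∕ _Bv`, `V_layer ∕ Vp_layer ∕ Vpp_layer ∕ Q_layer ∕ rd_layer` (the T₃-free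
functions are the frame's, `rfl`), `c13OfRecord_layer`, **`H_layer`** (H(Z) OF RECORD = Σ_{(𝐃,P) ∈ terms} (2.14): print's (2.9) with its terms displayed) and
`WtOfRecord_layer_H`; THE JUNCTION's DICTIONARY BINDERS IN THEIR EXACT SHAPES at `lam := lamK.layer`, `𝒦 := lamK.𝒦`, `uOf := lamK.uOf`, `lZ := lamK.lZ`,
`lD := fun _ t => lamK.lD t`, `Γm := lamK.Gam`, `χY₀ := lamK.chiY₀`, `χcP := lamK.chicP`, `Pl := lamK.Pl`, `rP := lamK.rP`, `Dfam := fun _ t => t.1`, `Vr := lamK.Vr`,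
`emb := lamK.emb`: **`norm_T₃_layer_le`** (`hT₃`, by `le_rfl`), `lZ_nodup ∕ lZ_toFinset ∕ lZ_spec` (`hlZ`), `lD_nodup ∕ lD_toFinset ∕ lD_spec` (`hlD`), `chicP_eq`
(`hχc`, `rfl`), `chiY₀_nonneg ∕ chiY₀_le_one` (`hχ0 ∕ hχ1`; also `chicP_nonneg ∕ _le_one`), `Gam_eq` (`hlin`, for EVERY σ), `Vr_eq` (`hVr`, unconditionally),
`rP_nonneg` (`hrP` ⇐ `0 ≤ ε₁`), `rP_eq_of_g_eq` (under the index law `g = v_k ≥ 0`: `rP = ε₁ ∕ v_k`).  §2 the family ∕ Stage-12 currencies of g3 ∕ g2 over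
kernel-keyed layers: `ResidB13KFam θ`, `ResidB13KFam.layerFam` (`_apply : rfl`, `isStepIndexed_layerFam_iff : Iff.rfl`), `ResidB13KFam₁₂`, `layerFam₁₂`,
`Stage12Params.pinB13K θ lamK := θ.pinB13 (fun P => (lamK P).layer)` (`pinB13K_eq : rfl` — every g2 face applies by name).  §3 HONESTY — THE LEVER RELOCATED ONE
STOREY DOWN (refuter-grade): `chiY₀_mul_chicP_eq_zero` (a row bond `b ∈ Y0l Z t ∩ Pl Z t` kills χ_{k,Y₀}·χᶜ_{k,P} IDENTICALLY — print has `P ⊂ Y₀ᶜ*` in (2.3), a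
law the data does NOT carry), `F214_eq_zero_of_mem`, `cgaussMean_mul_zero`, `TopC_apply_zero ∕ term214_apply_zero` (the (2.14) operator annihilates the zero
function), **`core_eq_zero_of_mem`**, **`T₃_eq_zero_of_mem`**, **`H_layer_eq_zero_of_forall_exists_mem`** (at such kernel data the H OF RECORD VANISHES and g0's
zero-tower species (`exists_residB13_b13LeafOfRecord`, LOCATED-N10-ZEROTOWER) re-appears one storey down), and `exists_residB13K_H_layer_eq_zero` ∕
`nonempty_residB13K` (such data EXIST over any g0 layer: the free kernels `B13TermWalkDataOneTorus.freeKernels` on one row bond; the Type is inhabited).  So the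
content of Lemma 3 at THIS pin = NODE A's kernels OF RECORD — [13]'s `Δ_k(σ)`, `C^{(k)}(Z₀, σ)` and their located laws — and the rung, DISPLAYED downstream, not
supplied here.

CONSUMER RECIPE (Summits side, a dag-n10 successor; NOT this module — Literature does not import Summits): instantiate `b13LeafOfRecord_of_located_walks θ
lamK.layer` with the thirteen assignments above; the nine binders `hT₃ hlZ hlD hlin hχc hχ0 hχ1 hVr hrP` are this file's theorems (`norm_T₃_layer_le`, `lZ_spec`,
`lD_spec`, `fun Z t _ φ _ σ _ X => Gam_eq …`, `fun _ _ _ => rfl`, `chiY₀_nonneg`, `chiY₀_le_one`, `fun Z t _ φ _ Y _ B _ => rfl`, `rP_nonneg hε.le`); the rest displayed.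

HONEST FRAMING: definitions + kernel bookkeeping (`rfl` ∕ unfolding ∕ one vanishing computation); NO estimate; nothing of Bałaban's asserted or constructed (the
kernels, `uOf`, `r`, the χ-bond sets, `emb` are DATA, no law); N10 NOT discharged; K0′ untouched; counts unmoved; one finite 𝕋⁴ programme at fixed ε, Bałaban as
printed — NOT continuum ∕ ℝ⁴ ∕ infinite volume ∕ OS ∕ mass gap ∕ Clay.  No `sorry`, no `axiom`, no `opaque`, no `instance` declaration (structure-field instances
registered by `attribute [instance]`, as `Node00/Carriers.lean`), no `notation`. -/
noncomputable section

namespace Literature.MathematicalPhysics.QuantumFieldTheory.Balaban1983to89.Node00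

open T4Continuum AveragingRT T4FiniteEpsInhabited FlowStep FlowStepRuns DagBinding T4DatumAssembly
open MeasureTheory
open scoped Matrix
open Literature.MathematicalPhysics.QuantumFieldTheory.Balaban1983to89.TreeLengthTorus (TDom TPt tsys IsTDom)
open Literature.MathematicalPhysics.QuantumFieldTheory.Balaban1983to89.TreeLengthTorusTransfer (tclosure)
open Literature.MathematicalPhysics.QuantumFieldTheory.Balaban1983to89.B13Lemma3TorusData (TBond)
open Literature.MathematicalPhysics.QuantumFieldTheory.Balaban1983to89.B13Lemma3TorusTerms (terms Z0)
open Literature.MathematicalPhysics.QuantumFieldTheory.Balaban1983to89.B13Term214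
  (cauchyD TopC term214 cgaussWeight cgaussInt cgaussNorm cgaussMean integrand214 F214 core214)
open Literature.MathematicalPhysics.QuantumFieldTheory.Balaban1983to89.B13TermWalkData (TermKernels)
open Literature.MathematicalPhysics.QuantumFieldTheory.Balaban1983to89.B13TermWalkDataOneTorus (freeKernels)
open Literature.MathematicalPhysics.QuantumFieldTheory.Balaban1983to89.B5TorusCover (UT)

/-! ## §1. The kernel-keyed residual layer, the (2.14) term of record, the layer of record and its faces -/

section Tower

variable (θ : Stage3Params)

/-- The index type of the terms `(𝐃, P)` of `H(Z)` on the fine torus with `(θ.ℓ₆+1)·(n+1)` M-cubes per direction and bond fineness `m₃ + 1`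
(`B13Lemma3TorusTerms.terms (θ.ℓ₆+1) (m₃+1) Z ⊂` this type). [cite: Balaban1988RG2Cluster, (2.9) p.14 (the sum over 𝐃, P)] -/
abbrev B13TermIdx (n m₃ : ℕ) : Type :=
  Finset (TDom 4 ((θ.ℓ₆ + 1) * (n + 1))) × Finset (TBond 4 (m₃ + 1) ((θ.ℓ₆ + 1) * (n + 1)))

/-- **The KERNEL-KEYED residual [B13] term layer at Stage-3 parameters `θ`** (DATA, no law): every field of g0's `ResidB13 θ` EXCEPT the terms `T₃` of H, PLUS
the kernel-side data of print's (2.14) per term `t = (𝐃, P)` of every `Z ∈ 𝐃_{k+1}` — [13]'s site torus, the kernels' configuration space, NODE A's kernel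
record `𝒦 Z t` (the operators `C^{(k)}(Z₀,σ(Z))⁻¹`, `Γ_k(Z₀,σ(Z))` as σ- and configuration-dependent matrices on the row bonds, with real references and
locations), the configuration reading `uOf`, the Cauchy radius `r`, the χ-bond sets of (2.3), and the configuration-with-fluctuation map `emb`.  The terms of H
are then DEFINED from these (`ResidB13K.T₃`). [cite: Balaban1988RG2Cluster, (2.3) p.12, (2.9) p.14, (2.14) p.15, p.13; Balaban1985BackgroundPropagators, Thm 3.10 p.416] -/
structure ResidB13K where
  /-- coarse torus: `n + 1` LM-cubes per direction (fine torus: `(θ.ℓ₆+1)·(n+1)` M-cubes per direction) -/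
  n : ℕ
  /-- the step index k -/
  k : ℕ
  /-- the configurations (𝐔, 𝐉, B) (complexified), as a complex normed space -/
  Φ : Type
  [normedΦ : NormedAddCommGroup Φ]
  [spaceΦ : NormedSpace ℂ Φ]
  /-- the bonds carrying the fluctuation variable B -/
  Bond : Type
  [finBond : Fintype Bond]
  /-- the space (1.34) of Y ∈ 𝐃_k -/
  sp1 : TDom 4 ((θ.ℓ₆ + 1) * (n + 1)) → Set Φ
  /-- the space Uᶜ_{k+1}(·, α₀, α₁) of p. 15 of Z ∈ 𝐃_{k+1} -/
  sp2 : TDom 4 (n + 1) → Set Φ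
  /-- the bond variables B(b) -/
  Bv : Φ → Bond → ℂ
  /-- (1.33): anchors -/
  S0 : TDom 4 ((θ.ℓ₆ + 1) * (n + 1)) → Finset (TPt 4 ((θ.ℓ₆ + 1) * (n + 1)))
  /-- (1.33): the cubes Y₀ ranges over -/
  F : TDom 4 ((θ.ℓ₆ + 1) * (n + 1)) → TPt 4 ((θ.ℓ₆ + 1) * (n + 1)) → Finset (TPt 4 ((θ.ℓ₆ + 1) * (n + 1)))
  /-- (1.33): the j-cubes -/
  Sq : TDom 4 ((θ.ℓ₆ + 1) * (n + 1)) → TPt 4 ((θ.ℓ₆ + 1) * (n + 1)) → (j : ℕ) →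
    Finset (TPt 4 ((θ.ℓ₆ + 1) ^ (k - j) * ((θ.ℓ₆ + 1) * (n + 1))))
  /-- (1.33): the j-domains -/
  SX : TDom 4 ((θ.ℓ₆ + 1) * (n + 1)) → TPt 4 ((θ.ℓ₆ + 1) * (n + 1)) → (j : ℕ) →
    TPt 4 ((θ.ℓ₆ + 1) ^ (k - j) * ((θ.ℓ₆ + 1) * (n + 1))) → Finset (TDom 4 ((θ.ℓ₆ + 1) ^ (k - j) * ((θ.ℓ₆ + 1) * (n + 1))))
  /-- (1.33): the terms localized in Y -/
  T : TDom 4 ((θ.ℓ₆ + 1) * (n + 1)) → TPt 4 ((θ.ℓ₆ + 1) * (n + 1)) → Finset (TPt 4 ((θ.ℓ₆ + 1) * (n + 1))) → (j : ℕ) →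
    TPt 4 ((θ.ℓ₆ + 1) ^ (k - j) * ((θ.ℓ₆ + 1) * (n + 1))) → TDom 4 ((θ.ℓ₆ + 1) ^ (k - j) * ((θ.ℓ₆ + 1) * (n + 1))) → Φ → ℂ
  /-- (1.33), chain part: anchors -/
  Sc : TDom 4 ((θ.ℓ₆ + 1) * (n + 1)) → Finset (TPt 4 ((θ.ℓ₆ + 1) * (n + 1)))
  /-- (1.33), chain part: j-cubes -/
  Sq' : TDom 4 ((θ.ℓ₆ + 1) * (n + 1)) → TPt 4 ((θ.ℓ₆ + 1) * (n + 1)) → (j : ℕ) →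
    Finset (TPt 4 ((θ.ℓ₆ + 1) ^ (k - j) * ((θ.ℓ₆ + 1) * (n + 1))))
  /-- (1.33), chain part: j-domains -/
  SX' : TDom 4 ((θ.ℓ₆ + 1) * (n + 1)) → TPt 4 ((θ.ℓ₆ + 1) * (n + 1)) → (j : ℕ) →
    TPt 4 ((θ.ℓ₆ + 1) ^ (k - j) * ((θ.ℓ₆ + 1) * (n + 1))) → Finset (TDom 4 ((θ.ℓ₆ + 1) ^ (k - j) * ((θ.ℓ₆ + 1) * (n + 1))))
  /-- (1.33), chain part: terms -/
  T' : TDom 4 ((θ.ℓ₆ + 1) * (n + 1)) → TPt 4 ((θ.ℓ₆ + 1) * (n + 1)) → (j : ℕ) →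
    TPt 4 ((θ.ℓ₆ + 1) ^ (k - j) * ((θ.ℓ₆ + 1) * (n + 1))) → TDom 4 ((θ.ℓ₆ + 1) ^ (k - j) * ((θ.ℓ₆ + 1) * (n + 1))) → Φ → ℂ
  /-- (1.41)–(1.42): the curvature terms -/
  Gl : TDom 4 ((θ.ℓ₆ + 1) * (n + 1)) → Φ → ℂ
  /-- (1.40): the one-plaquette variable space -/
  E : Type
  [normedE : NormedAddCommGroup E]
  [spaceE : NormedSpace ℂ E]
  /-- (1.41): plaquette indices and the plaquettes of Y -/
  ι₂ : Type
  s : TDom 4 ((θ.ℓ₆ + 1) * (n + 1)) → Finset ι₂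
  /-- (1.40)–(1.41): the one-plaquette terms -/
  Wf : TDom 4 ((θ.ℓ₆ + 1) * (n + 1)) → ι₂ → Φ → E → ℂ
  /-- [I] (2.12): the running coupling g_k of B = g_k B′ -/
  g : ℂ
  /-- (1.40): bond-to-plaquette-variable vectors -/
  e : TDom 4 ((θ.ℓ₆ + 1) * (n + 1)) → Bond → E
  /-- (2.3): bond fineness `m₃ + 1` of the terms of H -/
  m₃ : ℕ
  /-- p. 21: E^{(k+1)}(X) -/
  Ek1 : TDom 4 (n + 1) → Φ → ℂ
  /-- p. 21: the log Z^{(k)} terms localized in X -/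
  Elog : TDom 4 (n + 1) → Φ → ℂ
  /-- (I.3.29): gauge invariance -/
  GaugeInv : (Φ → ℂ) → Prop
  /-- (I.1.7) -/
  Repr17 : Prop
  /-- Lemma 3's restriction sentence -/
  Restr : Prop
  /-- the constants of [II] but `L` -/
  c : B13.Consts
  /-- [13]: the dimension index of the site torus of the walks -/
  ν : ℕ
  /-- [13]: the periods of the site torus `UT Nf` -/
  Nf : Fin ν → ℕ
  [neNf : ∀ i, NeZero (Nf i)]
  /-- the configuration argument space of the kernels (p. 15: (𝐔, 𝐉) with U = U′U, small A′, J) -/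
  E₃ : Type
  [normedE₃ : NormedAddCommGroup E₃]
  [spaceE₃ : NormedSpace ℂ E₃]
  /-- (2.14) p. 15 ∕ p. 13: NODE A's kernel data of the term `t = (𝐃, P)` of `Z` — `A(σ,u) = C^{(k)}(Z₀,σ(Z))⁻¹`, `G(σ,u)` of `Γ_k(Z₀,σ(Z))`, references, locations -/
  𝒦 : TDom 4 (n + 1) → B13TermIdx θ n m₃ → TermKernels ({ c with L := θ.ℓ₆ + 1 } : B13.Consts) 4 (n + 1) ν Nf E₃
  [finC₀ : ∀ Z t, Fintype (𝒦 Z t).C₀]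
  [decC₀ : ∀ Z t, DecidableEq (𝒦 Z t).C₀]
  /-- p. 15: the configuration `u` the kernels read at `φ` -/
  uOf : TDom 4 (n + 1) → B13TermIdx θ n m₃ → Φ → E₃
  /-- (2.14): the radius of the Cauchy contours `|σ(Δ) − s(Δ)| = r`, `|τ(Y) − t(Y)| = r` -/
  r : ℝ
  /-- (2.3): the row bonds of χ_{k,Y₀} -/
  Y0l : (Z : TDom 4 (n + 1)) → (t : B13TermIdx θ n m₃) → Finset (𝒦 Z t).Λ
  /-- (2.3): the row bonds of P (χᶜ_{k,P}) -/
  Pl : (Z : TDom 4 (n + 1)) → (t : B13TermIdx θ n m₃) → Finset (𝒦 Z t).Λ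
  /-- the configuration `φ` with real fluctuation field `B` on the row bonds -/
  emb : (Z : TDom 4 (n + 1)) → (t : B13TermIdx θ n m₃) → Φ → ((𝒦 Z t).Λ → ℝ) → Φ

attribute [instance] ResidB13K.normedΦ ResidB13K.spaceΦ ResidB13K.finBond ResidB13K.normedE ResidB13K.spaceE ResidB13K.neNf
  ResidB13K.normedE₃ ResidB13K.spaceE₃ ResidB13K.finC₀ ResidB13K.decC₀

variable {θ}

/-- **Attach kernel data to a g0 layer** (its free terms `T₃` are dropped; the terms become the (2.14) displays of the kernels).
[cite: Balaban1988RG2Cluster, (2.14) p.15 (the term as a display of the kernels)] -/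
def ResidB13.withKernels (lam : ResidB13 θ) (ν : ℕ) (Nf : Fin ν → ℕ) [∀ i, NeZero (Nf i)] (E₃ : Type) [NormedAddCommGroup E₃]
    [NormedSpace ℂ E₃] (𝒦 : TDom 4 (lam.n + 1) → B13TermIdx θ lam.n lam.m₃ → TermKernels ({ lam.c with L := θ.ℓ₆ + 1 } : B13.Consts) 4 (lam.n + 1) ν Nf E₃)
    [finC : ∀ Z t, Fintype (𝒦 Z t).C₀] [decC : ∀ Z t, DecidableEq (𝒦 Z t).C₀] (uOf : TDom 4 (lam.n + 1) → B13TermIdx θ lam.n lam.m₃ → lam.Φ → E₃) (r : ℝ)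
    (Y0l Pl : (Z : TDom 4 (lam.n + 1)) → (t : B13TermIdx θ lam.n lam.m₃) → Finset (𝒦 Z t).Λ)
    (emb : (Z : TDom 4 (lam.n + 1)) → (t : B13TermIdx θ lam.n lam.m₃) → lam.Φ → ((𝒦 Z t).Λ → ℝ) → lam.Φ) : ResidB13K θ where
  n := lam.n
  k := lam.k
  Φ := lam.Φ
  Bond := lam.Bond
  sp1 := lam.sp1
  sp2 := lam.sp2
  Bv := lam.Bv
  S0 := lam.S0
  F := lam.F
  Sq := lam.Sq
  SX := lam.SX
  T := lam.T
  Sc := lam.Sc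
  Sq' := lam.Sq'
  SX' := lam.SX'
  T' := lam.T'
  Gl := lam.Gl
  E := lam.E
  ι₂ := lam.ι₂
  s := lam.s
  Wf := lam.Wf
  g := lam.g
  e := lam.e
  m₃ := lam.m₃
  Ek1 := lam.Ek1
  Elog := lam.Elog
  GaugeInv := lam.GaugeInv
  Repr17 := lam.Repr17
  Restr := lam.Restr
  c := lam.c
  ν := ν
  Nf := Nf
  E₃ := E₃
  𝒦 := 𝒦
  uOf := uOf
  r := r
  Y0l := Y0l
  Pl := Pl
  emb := emb

namespace ResidB13K

variable (lamK : ResidB13K θ)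

/-- **The T₃-free frame** of a kernel-keyed layer: the g0 layer with the SAME (1.33) ∕ (1.40)–(1.42) ∕ p. 21 data and `T₃ := 0` (AUXILIARY: only its
T₃-independent functions `V ∕ Vp ∕ Vpp ∕ Q ∕ rd` are read — by `Vr` below and by the faces of `layer`). [cite: Balaban1988RG2Cluster, (1.33) p.9, (1.40)–(1.42) pp.10–11 (bookkeeping)] -/
def frame : ResidB13 θ where
  n := lamK.n
  k := lamK.k
  Φ := lamK.Φ
  Bond := lamK.Bond
  sp1 := lamK.sp1
  sp2 := lamK.sp2
  Bv := lamK.Bv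
  S0 := lamK.S0
  F := lamK.F
  Sq := lamK.Sq
  SX := lamK.SX
  T := lamK.T
  Sc := lamK.Sc
  Sq' := lamK.Sq'
  SX' := lamK.SX'
  T' := lamK.T'
  Gl := lamK.Gl
  E := lamK.E
  ι₂ := lamK.ι₂
  s := lamK.s
  Wf := lamK.Wf
  g := lamK.g
  e := lamK.e
  m₃ := lamK.m₃
  T₃ := fun _ _ _ => 0
  Ek1 := lamK.Ek1
  Elog := lamK.Elog
  GaugeInv := lamK.GaugeInv
  Repr17 := lamK.Repr17
  Restr := lamK.Restr
  c := lamK.c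

/-- **(2.3) p. 12: the small-field threshold `ε₁∕g_k`** of χ_k ∕ χ_{k,Y₀} ∕ χᶜ_{k,P} at the layer's coupling letter `g` ([I] (2.12), `B = g_k B′`; [I] (2.9):
χ_k = Πχ({|B′(b)| < ε₁})). [cite: Balaban1988RG2Cluster, (2.3) p.12; Balaban1987RG1, (2.9) p.266 and (2.12) p.268] -/
def rP : ℝ := lamK.c.ε₁ / ‖lamK.g‖

/-- **χ_{k,Y₀}(B) := Π_{b ∈ Y0l} χ({|B(b)| < ε₁∕g_k})** (2.3). [cite: Balaban1988RG2Cluster, (2.3) p.12] -/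
def chiY₀ (Z : TDom 4 (lamK.n + 1)) (t : B13TermIdx θ lamK.n lamK.m₃) (B : (lamK.𝒦 Z t).Λ → ℝ) : ℝ :=
  ∏ b ∈ lamK.Y0l Z t, (if |B b| < lamK.rP then (1 : ℝ) else 0)

/-- **χᶜ_{k,P}(B) := Π_{b ∈ P} χ({|B(b)| ≥ ε₁∕g_k})** (2.3) (the junction's `hχc` right-hand side). [cite: Balaban1988RG2Cluster, (2.3) p.12] -/
def chicP (Z : TDom 4 (lamK.n + 1)) (t : B13TermIdx θ lamK.n lamK.m₃) (B : (lamK.𝒦 Z t).Λ → ℝ) : ℝ :=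
  ∏ b ∈ lamK.Pl Z t, (if lamK.rP ≤ |B b| then (1 : ℝ) else 0)

/-- **Γ_k(Z₀, σ(Z))X := G(σ, u)·X** at the configuration `u = uOf Z t φ` (p. 15 after (2.14); the junction's `hlin` right-hand side).
[cite: Balaban1988RG2Cluster, (2.14) p.15 (Γ_k(Z₀,σ(Z)) = C*Δ_k(σ(Z))CZ₀ᶜ(C^{(k)})^{1/2}(σ(Z)))] -/
def Gam (Z : TDom 4 (lamK.n + 1)) (t : B13TermIdx θ lamK.n lamK.m₃) (φ : lamK.Φ) (σ : TPt 4 (lamK.n + 1) → ℂ)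
    (X : (lamK.𝒦 Z t).Λ ⊕ (lamK.𝒦 Z t).C₀ → ℝ) : (lamK.𝒦 Z t).Λ → ℂ :=
  (lamK.𝒦 Z t).G2 σ (lamK.uOf Z t φ) *ᵥ fun j => (X j : ℂ)

/-- **𝐕_k(Y, B)** of (2.14)'s last exponent: the (1.41) potential OF RECORD (g0's `ResidB13.V` of the frame) at the configuration `φ` with real fluctuation
field `B` on the row bonds (the junction's `hVr` right-hand side). [cite: Balaban1988RG2Cluster, (2.14) p.15 and (1.41) p.11] -/
def Vr (Z : TDom 4 (lamK.n + 1)) (t : B13TermIdx θ lamK.n lamK.m₃) (φ : lamK.Φ) (Y : TDom 4 ((θ.ℓ₆ + 1) * (lamK.n + 1)))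
    (B : (lamK.𝒦 Z t).Λ → ℝ) : ℂ :=
  lamK.frame.V Y (lamK.emb Z t φ B)

/-- **The σ-parameter list of (2.14): the cubes `Δ ⊂ Z ∖ Z′₀`** (Z′₀ = the closure in 𝐃_{k+1} of the term's Z₀, `tclosure` of `Z0`), as a list.
[cite: Balaban1988RG2Cluster, (2.14) p.15 (Π_{Δ⊂Z∖Z′₀}) and p.13 (Z′₀)] -/
def lZ (Z : TDom 4 (lamK.n + 1)) (t : B13TermIdx θ lamK.n lamK.m₃) : List (TPt 4 (lamK.n + 1)) :=
  (Z.1 \ tclosure (θ.ℓ₆ + 1) (lamK.n + 1) (Z0 (lamK.m₃ + 1) t)).toList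

/-- **The τ-parameter list of (2.14): the domains `Y ∈ 𝐃`**, as a list. [cite: Balaban1988RG2Cluster, (2.14) p.15 (Π_{Y∈𝐃})] -/
def lD (t : B13TermIdx θ lamK.n lamK.m₃) : List (TDom 4 ((θ.ℓ₆ + 1) * (lamK.n + 1))) := t.1.toList

/-- **The X-integral Ψ(σ, τ) of (2.14)** (lines 2–4: `∫dμ₀(X)|_Z exp(−½⟨ΓX, C^{(k)}ΓX⟩) ∫dμ_{C^{(k)}(Z₀,σ)}(B) exp(−⟨B, ΓX⟩) (−1)^{|P|} χ_{k,Y₀} χᶜ_{k,P}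
exp[Σ_{Y∈𝐃} τ(Y)𝐕_k(Y,B)]`) for the term's kernels at the configuration. [cite: Balaban1988RG2Cluster, (2.14) p.15] -/
def core (Z : TDom 4 (lamK.n + 1)) (t : B13TermIdx θ lamK.n lamK.m₃) (φ : lamK.Φ) :
    (TPt 4 (lamK.n + 1) → ℂ) → (TDom 4 ((θ.ℓ₆ + 1) * (lamK.n + 1)) → ℂ) → ℂ :=
  core214 (fun σ => (lamK.𝒦 Z t).A2 σ (lamK.uOf Z t φ)) (lamK.Gam Z t φ)
    (F214 t.2.card (lamK.chiY₀ Z t) (lamK.chicP Z t) t.1 (lamK.Vr Z t φ))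

open Classical in
/-- **THE (2.14) TERM OF RECORD** `T_{(𝐃,P)}(Z)(φ) := term214 r (Z∖Z′₀) 𝐃 Ψ 0 0` — print's Cauchy operators in `σ(Δ)`, `τ(Y)` applied to the X-integral, base
points `σ = 0` off `Z∖Z′₀` ((2.8)) and `τ = 0` ((2.1)). [cite: Balaban1988RG2Cluster, (2.14) p.15, (2.8) p.14, (2.1) p.12] -/
def T₃ (Z : TDom 4 (lamK.n + 1)) (t : B13TermIdx θ lamK.n lamK.m₃) (φ : lamK.Φ) : ℂ :=
  term214 lamK.r (lamK.lZ Z t) (lamK.lD t) (lamK.core Z t φ) 0 0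

/-- **THE [B13] LAYER OF RECORD KEYED ON THE KERNEL FAMILY**: the frame with ITS TERMS OF H := the (2.14) terms of record.  Every g0 ∕ g2 ∕ g3 object applies to it
by name (`WtOfRecord θ lamK.layer`, `B13LeafOfRecord θ lamK.layer`, the pins, the families). [cite: Balaban1988RG2Cluster, (2.9) p.14 and (2.14) p.15] -/
def layer : ResidB13 θ := { lamK.frame with T₃ := lamK.T₃ }

/-! ### Faces of the layer of record (`rfl`) -/

/-- [cite: Balaban1988RG2Cluster, (2.14) p.15 (bookkeeping)] -/
@[simp] theorem layer_n : lamK.layer.n = lamK.n := rfl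
/-- [cite: Balaban1988RG2Cluster, (1.33) p.9 (bookkeeping)] -/
@[simp] theorem layer_k : lamK.layer.k = lamK.k := rfl
/-- [cite: Balaban1988RG2Cluster, (2.3) p.12 (bookkeeping)] -/
@[simp] theorem layer_m₃ : lamK.layer.m₃ = lamK.m₃ := rfl
/-- [cite: Balaban1987RG1, (2.12) p.268 (bookkeeping)] -/
@[simp] theorem layer_g : lamK.layer.g = lamK.g := rfl
/-- [cite: Balaban1988RG2Cluster, p.20 (bookkeeping)] -/
@[simp] theorem layer_c : lamK.layer.c = lamK.c := rfl
/-- [cite: Balaban1988RG2Cluster, (1.34) p.9 (bookkeeping)] -/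
theorem layer_Φ : lamK.layer.Φ = lamK.Φ := rfl
/-- [cite: Balaban1988RG2Cluster, (1.34) p.9 (bookkeeping)] -/
@[simp] theorem layer_sp1 : lamK.layer.sp1 = lamK.sp1 := rfl
/-- [cite: Balaban1988RG2Cluster, p.15 (bookkeeping)] -/
@[simp] theorem layer_sp2 : lamK.layer.sp2 = lamK.sp2 := rfl
/-- [cite: Balaban1988RG2Cluster, (1.40) p.10 (bookkeeping)] -/
@[simp] theorem layer_Bv : lamK.layer.Bv = lamK.Bv := rfl
/-- [cite: Balaban1988RG2Cluster, (I.3.29) via Lemma 2 p.11 (bookkeeping)] -/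
@[simp] theorem layer_GaugeInv : lamK.layer.GaugeInv = lamK.GaugeInv := rfl
/-- [cite: Balaban1988RG2Cluster, Lemma 3 p.20 (bookkeeping)] -/
@[simp] theorem layer_Restr : lamK.layer.Restr = lamK.Restr := rfl
/-- The frame's T₃-free data are the layer's (`rfl`). [cite: Balaban1988RG2Cluster, (1.33) p.9 (bookkeeping)] -/
theorem frame_n : lamK.frame.n = lamK.n := rfl
/-- [cite: Balaban1988RG2Cluster, p.20 (bookkeeping)] -/
theorem frame_c : lamK.frame.c = lamK.c := rfl

open Classical in
/-- **THE TERMS OF H OF THE LAYER OF RECORD ARE THE (2.14) TERMS** (`rfl`). [cite: Balaban1988RG2Cluster, (2.14) p.15] -/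
theorem layer_T₃ (Z : TDom 4 (lamK.n + 1)) (t : B13TermIdx θ lamK.n lamK.m₃) (φ : lamK.Φ) :
    lamK.layer.T₃ Z t φ = term214 lamK.r (lamK.lZ Z t) (lamK.lD t) (lamK.core Z t φ) 0 0 := rfl

/-- `layer.T₃ = T₃` as functions (`rfl`). [cite: Balaban1988RG2Cluster, (2.14) p.15 (bookkeeping)] -/
theorem layer_T₃_eq : lamK.layer.T₃ = lamK.T₃ := rfl

/-- The (1.41) potential of the layer of record is the frame's (`rfl`: `V` does not read `T₃`). [cite: Balaban1988RG2Cluster, (1.41) p.11 (bookkeeping)] -/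
theorem V_layer : lamK.layer.V = lamK.frame.V := rfl
/-- [cite: Balaban1988RG2Cluster, (1.33) p.9 (bookkeeping)] -/
theorem Vp_layer : lamK.layer.Vp = lamK.frame.Vp := rfl
/-- [cite: Balaban1988RG2Cluster, (1.41)–(1.42) p.11 (bookkeeping)] -/
theorem Vpp_layer : lamK.layer.Vpp = lamK.frame.Vpp := rfl
/-- [cite: Balaban1988RG2Cluster, (1.40)–(1.42) pp.10–11 (bookkeeping)] -/
theorem Q_layer : lamK.layer.Q = lamK.frame.Q := rfl
/-- [cite: Balaban1988RG2Cluster, (1.40) p.10 (bookkeeping)] -/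
theorem rd_layer : lamK.layer.rd = lamK.frame.rd := rfl

/-- The (1.41) potential of the layer of record, displayed (`rfl`). [cite: Balaban1988RG2Cluster, (1.41) p.11] -/
theorem V_layer_apply (Y : TDom 4 ((θ.ℓ₆ + 1) * (lamK.n + 1))) (φ : lamK.Φ) :
    lamK.layer.V Y φ = (∑ i ∈ lamK.s Y, B13PkScaling.scaled lamK.g (lamK.Wf Y i φ) (lamK.frame.rd Y φ)) + lamK.frame.Vpp Y φ := rfl

/-- The constants of record of the layer of record (`rfl`; the type the kernel field `𝒦` is stated at). [cite: Balaban1988RG2Cluster, p.20 (bookkeeping)] -/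
theorem c13OfRecord_layer : c13OfRecord θ lamK.layer = ({ lamK.c with L := θ.ℓ₆ + 1 } : B13.Consts) := rfl

open Classical in
/-- **H(Z) OF RECORD = Σ_{(𝐃,P) ∈ terms} (2.14)** — print's (2.9) with each term the (2.14) display of the kernels (`rfl`). [cite: Balaban1988RG2Cluster, (2.9) p.14 and (2.14) p.15] -/
theorem H_layer (Z : TDom 4 (lamK.n + 1)) (φ : lamK.Φ) :
    lamK.layer.H Z φ = ∑ t ∈ terms (θ.ℓ₆ + 1) (lamK.m₃ + 1) Z, term214 lamK.r (lamK.lZ Z t) (lamK.lD t) (lamK.core Z t φ) 0 0 := rfl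

/-- The step of record's H at the layer of record (`rfl`). [cite: Balaban1988RG2Cluster, (2.9) p.14 and (2.14) p.15] -/
theorem WtOfRecord_layer_H (Z : TDom 4 (lamK.n + 1)) (φ : lamK.Φ) :
    (WtOfRecord θ lamK.layer).H Z φ = ∑ t ∈ terms (θ.ℓ₆ + 1) (lamK.m₃ + 1) Z, lamK.T₃ Z t φ := rfl

/-! ### The walks junction's dictionary binders, DISCHARGED at the layer of record -/

open Classical in
/-- **`hT₃` DISCHARGED (`le_rfl`)**: the layer's term IS the (2.14) display of its kernels, hence dominated by it — in the exact shape of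
`N10AtRecord11B13Walks.b13LeafOfRecord_of_located_walks`'s dictionary binder at `𝒦 := lamK.𝒦`, `uOf := lamK.uOf`, `lZ := lamK.lZ`, `lD := fun _ t => lamK.lD t`,
`Γm := lamK.Gam`, `χY₀ := lamK.chiY₀`, `χcP := lamK.chicP`, `Dfam := fun _ t => t.1`, `Vr := lamK.Vr`. [cite: Balaban1988RG2Cluster, (2.14) p.15] -/
theorem norm_T₃_layer_le (Z : TDom 4 (lamK.n + 1)) (t : B13TermIdx θ lamK.n lamK.m₃) (φ : lamK.Φ) :
    ‖lamK.layer.T₃ Z t φ‖ ≤ ‖term214 lamK.r (lamK.lZ Z t) (lamK.lD t)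
      (core214 (fun σ => (lamK.𝒦 Z t).A2 σ (lamK.uOf Z t φ)) (lamK.Gam Z t φ)
        (F214 t.2.card (lamK.chiY₀ Z t) (lamK.chicP Z t) t.1 (lamK.Vr Z t φ))) 0 0‖ :=
  le_rfl

/-- `hlZ`, first half: the σ-list has no duplicates. [cite: Balaban1988RG2Cluster, (2.14) p.15 (bookkeeping)] -/
theorem lZ_nodup (Z : TDom 4 (lamK.n + 1)) (t : B13TermIdx θ lamK.n lamK.m₃) : (lamK.lZ Z t).Nodup := Finset.nodup_toList _

/-- `hlZ`, second half: the σ-list enumerates `Z ∖ Z′₀`. [cite: Balaban1988RG2Cluster, (2.14) p.15 and p.13 (Z′₀)] -/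
theorem lZ_toFinset (Z : TDom 4 (lamK.n + 1)) (t : B13TermIdx θ lamK.n lamK.m₃) :
    (lamK.lZ Z t).toFinset = Z.1 \ tclosure (θ.ℓ₆ + 1) (lamK.n + 1) (Z0 (lamK.m₃ + 1) t) := Finset.toList_toFinset _

/-- **`hlZ` DISCHARGED** (both halves, for every term). [cite: Balaban1988RG2Cluster, (2.14) p.15 and p.13] -/
theorem lZ_spec (Z : TDom 4 (lamK.n + 1)) (t : B13TermIdx θ lamK.n lamK.m₃) :
    (lamK.lZ Z t).Nodup ∧ (lamK.lZ Z t).toFinset = Z.1 \ tclosure (θ.ℓ₆ + 1) (lamK.n + 1) (Z0 (lamK.m₃ + 1) t) :=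
  ⟨lamK.lZ_nodup Z t, lamK.lZ_toFinset Z t⟩

/-- `hlD`, first half. [cite: Balaban1988RG2Cluster, (2.14) p.15 (bookkeeping)] -/
theorem lD_nodup (t : B13TermIdx θ lamK.n lamK.m₃) : (lamK.lD t).Nodup := Finset.nodup_toList _

open Classical in
/-- `hlD`, second half: the τ-list enumerates 𝐃. [cite: Balaban1988RG2Cluster, (2.14) p.15 (bookkeeping)] -/
theorem lD_toFinset (t : B13TermIdx θ lamK.n lamK.m₃) : (lamK.lD t).toFinset = t.1 := Finset.toList_toFinset _

open Classical in
/-- **`hlD` DISCHARGED**. [cite: Balaban1988RG2Cluster, (2.14) p.15] -/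
theorem lD_spec (t : B13TermIdx θ lamK.n lamK.m₃) : (lamK.lD t).Nodup ∧ (lamK.lD t).toFinset = t.1 := ⟨lamK.lD_nodup t, lamK.lD_toFinset t⟩

/-- **`hχc` DISCHARGED (`rfl`)**: χᶜ_{k,P} IS the product of the large-field indicators over the bonds of P at the threshold `rP`. [cite: Balaban1988RG2Cluster, (2.3) p.12] -/
theorem chicP_eq (Z : TDom 4 (lamK.n + 1)) (t : B13TermIdx θ lamK.n lamK.m₃) (B : (lamK.𝒦 Z t).Λ → ℝ) :
    lamK.chicP Z t B = ∏ b ∈ lamK.Pl Z t, (if lamK.rP ≤ |B b| then (1 : ℝ) else 0) := rfl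

/-- χ_{k,Y₀} displayed (`rfl`). [cite: Balaban1988RG2Cluster, (2.3) p.12] -/
theorem chiY₀_eq (Z : TDom 4 (lamK.n + 1)) (t : B13TermIdx θ lamK.n lamK.m₃) (B : (lamK.𝒦 Z t).Λ → ℝ) :
    lamK.chiY₀ Z t B = ∏ b ∈ lamK.Y0l Z t, (if |B b| < lamK.rP then (1 : ℝ) else 0) := rfl

/-- **`hχ0` DISCHARGED**: `0 ≤ χ_{k,Y₀}`. [cite: Balaban1988RG2Cluster, (2.3) p.12 (a product of characteristic functions)] -/
theorem chiY₀_nonneg (Z : TDom 4 (lamK.n + 1)) (t : B13TermIdx θ lamK.n lamK.m₃) (B : (lamK.𝒦 Z t).Λ → ℝ) : 0 ≤ lamK.chiY₀ Z t B :=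
  Finset.prod_nonneg fun b _ => by split_ifs <;> norm_num

/-- **`hχ1` DISCHARGED**: `χ_{k,Y₀} ≤ 1`. [cite: Balaban1988RG2Cluster, (2.3) p.12 (a product of characteristic functions)] -/
theorem chiY₀_le_one (Z : TDom 4 (lamK.n + 1)) (t : B13TermIdx θ lamK.n lamK.m₃) (B : (lamK.𝒦 Z t).Λ → ℝ) : lamK.chiY₀ Z t B ≤ 1 :=
  Finset.prod_le_one (fun b _ => by split_ifs <;> norm_num) fun b _ => by split_ifs <;> norm_num

/-- `0 ≤ χᶜ_{k,P}`. [cite: Balaban1988RG2Cluster, (2.3) p.12 (a product of characteristic functions)] -/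
theorem chicP_nonneg (Z : TDom 4 (lamK.n + 1)) (t : B13TermIdx θ lamK.n lamK.m₃) (B : (lamK.𝒦 Z t).Λ → ℝ) : 0 ≤ lamK.chicP Z t B :=
  Finset.prod_nonneg fun b _ => by split_ifs <;> norm_num

/-- `χᶜ_{k,P} ≤ 1`. [cite: Balaban1988RG2Cluster, (2.3) p.12 (a product of characteristic functions)] -/
theorem chicP_le_one (Z : TDom 4 (lamK.n + 1)) (t : B13TermIdx θ lamK.n lamK.m₃) (B : (lamK.𝒦 Z t).Λ → ℝ) : lamK.chicP Z t B ≤ 1 :=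
  Finset.prod_le_one (fun b _ => by split_ifs <;> norm_num) fun b _ => by split_ifs <;> norm_num

/-- Each characteristic function takes the values 0, 1 only. [cite: Balaban1988RG2Cluster, (2.3) p.12 (characteristic functions)] -/
theorem chiY₀_eq_zero_or_one (Z : TDom 4 (lamK.n + 1)) (t : B13TermIdx θ lamK.n lamK.m₃) (B : (lamK.𝒦 Z t).Λ → ℝ) :
    lamK.chiY₀ Z t B = 0 ∨ lamK.chiY₀ Z t B = 1 := by
  unfold chiY₀
  by_cases h : ∃ b ∈ lamK.Y0l Z t, ¬ |B b| < lamK.rP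
  · obtain ⟨b, hb, hlt⟩ := h
    exact Or.inl (Finset.prod_eq_zero hb (if_neg hlt))
  · push Not at h
    exact Or.inr (Finset.prod_eq_one fun b hb => if_pos (h b hb))

/-- **`hlin` DISCHARGED (`rfl`, for EVERY σ)**: Γ(σ)X = G(σ,u)·X. [cite: Balaban1988RG2Cluster, (2.14) p.15 (Γ_k(Z₀,σ(Z)))] -/
theorem Gam_eq (Z : TDom 4 (lamK.n + 1)) (t : B13TermIdx θ lamK.n lamK.m₃) (φ : lamK.Φ) (σ : TPt 4 (lamK.n + 1) → ℂ)
    (X : (lamK.𝒦 Z t).Λ ⊕ (lamK.𝒦 Z t).C₀ → ℝ) :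
    lamK.Gam Z t φ σ X = (lamK.𝒦 Z t).G2 σ (lamK.uOf Z t φ) *ᵥ fun j => (X j : ℂ) := rfl

/-- **`hVr` DISCHARGED (`rfl`, unconditionally)**: 𝐕_k(Y, B) = the layer of record's (1.41) potential at the configuration with fluctuation B.
[cite: Balaban1988RG2Cluster, (2.14) p.15 and (1.41) p.11] -/
theorem Vr_eq (Z : TDom 4 (lamK.n + 1)) (t : B13TermIdx θ lamK.n lamK.m₃) (φ : lamK.Φ) (Y : TDom 4 ((θ.ℓ₆ + 1) * (lamK.n + 1)))
    (B : (lamK.𝒦 Z t).Λ → ℝ) : lamK.Vr Z t φ Y B = lamK.layer.V Y (lamK.emb Z t φ B) := rfl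

/-- **`hrP` DISCHARGED** from the sign of ε₁: `0 ≤ ε₁∕g_k`. [cite: Balaban1988RG2Cluster, (2.3) p.12 and (1.36) p.9 (ε₁ > 0)] -/
theorem rP_nonneg (hε : 0 ≤ lamK.c.ε₁) : 0 ≤ lamK.rP := div_nonneg hε (norm_nonneg _)

/-- The threshold displayed (`rfl`). [cite: Balaban1988RG2Cluster, (2.3) p.12] -/
theorem rP_eq : lamK.rP = lamK.c.ε₁ / ‖lamK.g‖ := rfl

/-- Under the index law `g = v_k` with `0 ≤ v_k` (g3's `ResidB13Fam.IsStepIndexed` on the box) the threshold reads `ε₁∕v_k` — print's `ε₁∕g_k`.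
[cite: Balaban1988RG2Cluster, (2.3) p.12; Balaban1987RG1, Thm 1 p.259 (0 < g_k ≦ γ)] -/
theorem rP_eq_of_g_eq {x : ℝ} (hg : lamK.g = (x : ℂ)) (hx : 0 ≤ x) : lamK.rP = lamK.c.ε₁ / x := by
  rw [rP, hg, Complex.norm_real, Real.norm_of_nonneg hx]

/-- `0 < ε₁∕g_k` under the index law with `0 < v_k` and `0 < ε₁`. [cite: Balaban1988RG2Cluster, (2.3) p.12 and (1.36) p.9] -/
theorem rP_pos_of_g_eq {x : ℝ} (hg : lamK.g = (x : ℂ)) (hx : 0 < x) (hε : 0 < lamK.c.ε₁) : 0 < lamK.rP := by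
  rw [lamK.rP_eq_of_g_eq hg hx.le]
  exact div_pos hε hx

end ResidB13K

/-- The frame of a layer with attached kernels is the layer with `T₃ := 0` (`rfl`). [cite: Balaban1988RG2Cluster, (2.14) p.15 (bookkeeping)] -/
theorem ResidB13.withKernels_frame (lam : ResidB13 θ) (ν : ℕ) (Nf : Fin ν → ℕ) [∀ i, NeZero (Nf i)] (E₃ : Type) [NormedAddCommGroup E₃]
    [NormedSpace ℂ E₃] (𝒦 : TDom 4 (lam.n + 1) → B13TermIdx θ lam.n lam.m₃ → TermKernels ({ lam.c with L := θ.ℓ₆ + 1 } : B13.Consts) 4 (lam.n + 1) ν Nf E₃)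
    [finC : ∀ Z t, Fintype (𝒦 Z t).C₀] [decC : ∀ Z t, DecidableEq (𝒦 Z t).C₀] (uOf : TDom 4 (lam.n + 1) → B13TermIdx θ lam.n lam.m₃ → lam.Φ → E₃) (r : ℝ)
    (Y0l Pl : (Z : TDom 4 (lam.n + 1)) → (t : B13TermIdx θ lam.n lam.m₃) → Finset (𝒦 Z t).Λ)
    (emb : (Z : TDom 4 (lam.n + 1)) → (t : B13TermIdx θ lam.n lam.m₃) → lam.Φ → ((𝒦 Z t).Λ → ℝ) → lam.Φ) :
    (lam.withKernels ν Nf E₃ 𝒦 uOf r Y0l Pl emb).frame = { lam with T₃ := fun _ _ _ => 0 } := rfl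

end Tower

/-! ## §2. The family and Stage-12 currencies over kernel-keyed layers (g3's `ResidB13Fam`, g2's `Stage12Params.pinB13`, BY NAME) -/

section Family

variable (θ : Stage3Params)

/-- **A history-indexed kernel-keyed [B13] layer**: one `ResidB13K θ` per step `k` and coupling history `v ∈ ℝ^{k+1}` (g3's index set).
[cite: Balaban1987RG1, Thm 3 p.264; Balaban1988RG2Cluster, (2.14) p.15] -/
abbrev ResidB13KFam (θ : Stage3Params) := (k : ℕ) → (Fin (k + 1) → ℝ) → ResidB13K θ

variable {θ}

/-- **The family of layers of record** of a kernel-keyed family (member-wise `layer`); g3's `S13FamOfRecord ∕ B13FamLeafOfRecord ∕ IsStepIndexed` apply to it by name.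
[cite: Balaban1988RG2Cluster, (2.9) p.14 and (2.14) p.15; Balaban1987RG1, Thm 3 p.264] -/
def ResidB13KFam.layerFam (lamKF : ResidB13KFam θ) : ResidB13Fam θ := fun k v => (lamKF k v).layer

/-- Face (`rfl`). [cite: Balaban1988RG2Cluster, (2.14) p.15 (bookkeeping)] -/
@[simp] theorem ResidB13KFam.layerFam_apply (lamKF : ResidB13KFam θ) (k : ℕ) (v : Fin (k + 1) → ℝ) :
    ResidB13KFam.layerFam lamKF k v = (lamKF k v).layer := rfl

/-- The index law of the family of layers of record reads the members' `k` and `g` (`Iff.rfl`). [cite: Balaban1987RG1, (2.12) p.268 (bookkeeping)] -/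
theorem ResidB13KFam.isStepIndexed_layerFam_iff (lamKF : ResidB13KFam θ) (γ₀ : ℝ) :
    ResidB13Fam.IsStepIndexed γ₀ (ResidB13KFam.layerFam lamKF) ↔ ∀ k v, v ∈ FlowStep.Box γ₀ k → (lamKF k v).k = k ∧ (lamKF k v).g = ((v (Fin.last k) : ℝ) : ℂ) :=
  Iff.rfl

/-- The step data of record of the family of layers of record, member-wise (`rfl`). [cite: Balaban1988RG2Cluster, (1.33)–(1.42) pp.9–11, (2.9) p.14 (bookkeeping)] -/
theorem ResidB13KFam.S13FamOfRecord_layerFam (lamKF : ResidB13KFam θ) (k : ℕ) (v : Fin (k + 1) → ℝ) :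
    S13FamOfRecord θ (ResidB13KFam.layerFam lamKF) k v = (WtOfRecord θ (lamKF k v).layer).toStepData := rfl

end Family

section Stage12

variable (F : T4Family) (N : ℕ) [NeZero N]

/-- **A Stage-12 history-indexed kernel-keyed [B13] layer per run.** [cite: Balaban1988RG2Cluster, (2.14) p.15; Balaban1987RG1, Thm 3 p.264] -/
abbrev ResidB13KFam₁₂ (θ : Stage12Params F N) := B12.RunParams → ResidB13KFam θ.toStage3Params

variable {F N} in
/-- Its Stage-12 family of layers of record (run-wise `layerFam`); g3's `S13FamOfRecord₁₂ ∕ B13FamLeafOfRecord₁₂` apply to it by name.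
[cite: Balaban1988RG2Cluster, (2.14) p.15; Balaban1987RG1, Thm 3 p.264] -/
def ResidB13KFam₁₂.layerFam₁₂ {θ : Stage12Params F N} (lamKF : ResidB13KFam₁₂ F N θ) : ResidB13Fam₁₂ F N θ :=
  fun P => ResidB13KFam.layerFam (lamKF P)

variable {F N} in
/-- Face (`rfl`). [cite: Balaban1988RG2Cluster, (2.14) p.15 (bookkeeping)] -/
@[simp] theorem ResidB13KFam₁₂.layerFam₁₂_apply {θ : Stage12Params F N} (lamKF : ResidB13KFam₁₂ F N θ) (P : B12.RunParams) (k : ℕ) (v : Fin (k + 1) → ℝ) :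
    ResidB13KFam₁₂.layerFam₁₂ lamKF P k v = (lamKF P k v).layer := rfl

/-- **The kernel-keyed [B13] pin of Stage-12 parameters**: g2's `Stage12Params.pinB13` at the run-indexed layers of record (so every g2 face — `pinB13_X`,
`pinB13_admissible_iff`, `pinB13_toStage3Params`, `datumOfRecord₁₂_pinB13`, `b13_main_at_toStage5₁₂_pinB13`, the views — applies BY NAME).
[cite: Balaban1988RG2Cluster, Lemmas 1–3 pp.9–20 and (2.14) p.15 (objects of record)] -/
def Stage12Params.pinB13K (θ : Stage12Params F N) (lamK : B12.RunParams → ResidB13K θ.toStage3Params) : Stage12Params F N :=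
  θ.pinB13 F N fun P => (lamK P).layer

/-- Unfolding (`rfl`). [cite: Balaban1988RG2Cluster, Lemmas 1–3 pp.9–20 (bookkeeping)] -/
theorem Stage12Params.pinB13K_eq (θ : Stage12Params F N) (lamK : B12.RunParams → ResidB13K θ.toStage3Params) :
    θ.pinB13K F N lamK = θ.pinB13 F N (fun P => (lamK P).layer) := rfl

/-- The pinned carrier family, unfolded (`rfl`, g2's `pinB13_X`). [cite: Balaban1988RG2Cluster, Lemmas 1–3 (bookkeeping)] -/
theorem Stage12Params.pinB13K_X (θ : Stage12Params F N) (lamK : B12.RunParams → ResidB13K θ.toStage3Params) (P : B12.RunParams) :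
    (θ.pinB13K F N lamK).res.X P = (θ.res.X P).withB13OfRecord θ.toStage3Params (lamK P).layer := rfl

/-- The pin touches neither admissibility (`Iff.rfl`) … [cite: Balaban1987RG1, (1.20)–(1.21) p.264 (bookkeeping)] -/
theorem Stage12Params.pinB13K_admissible_iff (θ : Stage12Params F N) (lamK : B12.RunParams → ResidB13K θ.toStage3Params) :
    (θ.pinB13K F N lamK).Admissible F N ↔ θ.Admissible F N := Iff.rfl

/-- … nor the Stage-3 dictionary (`rfl`). [cite: Balaban1984PropagatorsII, pp.223–250 (bookkeeping)] -/
theorem Stage12Params.pinB13K_toStage3Params (θ : Stage12Params F N) (lamK : B12.RunParams → ResidB13K θ.toStage3Params) :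
    (θ.pinB13K F N lamK).toStage3Params = θ.toStage3Params := rfl

end Stage12

/-! ## §3. Honesty: the lever relocated one storey down (a P-bond among the Y₀-bonds kills the term of record), and non-vacuity -/

section Honesty

/-- The (2.14) operator `TopC` of the ZERO function is zero (each factor: a Cauchy integral of 0, then `∫₀¹ 0 = 0`).
[cite: Balaban1988RG2Cluster, (2.14) p.15 (elementary property of the display)] -/
theorem TopC_apply_zero {E : Type*} [NormedAddCommGroup E] [NormedSpace ℂ E] [CompleteSpace E] {ι : Type*} {_ : DecidableEq ι} (r : ℝ) :
    ∀ (l : List ι) (p : ι → ℂ), TopC r l (fun _ => (0 : E)) p = 0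
  | [], _ => rfl
  | i :: l, p => by
    simp [TopC, TopC_apply_zero r l, cauchyD, circleIntegral]

/-- `term214` of the ZERO X-integral is zero. [cite: Balaban1988RG2Cluster, (2.14) p.15 (elementary property of the display)] -/
theorem term214_apply_zero {E : Type*} [NormedAddCommGroup E] [NormedSpace ℂ E] [CompleteSpace E] {ι : Type*} {_ : DecidableEq ι} {κ : Type*}
    {_ : DecidableEq κ} (r : ℝ) (lZ : List ι) (lD : List κ) (σ₀ : ι → ℂ) (τ₀ : κ → ℂ) :
    term214 r lZ lD (fun _ _ => (0 : E)) σ₀ τ₀ = 0 := by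
  simp only [term214, TopC_apply_zero]

/-- A complex Gaussian mean of the zero function vanishes (whatever the complex precision; no convergence needed).
[cite: Balaban1988RG2Cluster, (2.14) p.15 (elementary property of the display)] -/
theorem cgaussMean_zero {Λ : Type} [Fintype Λ] {_ : DecidableEq Λ} (A : Matrix Λ Λ ℂ) : cgaussMean A (fun _ => 0) = 0 := by
  simp [cgaussMean, cgaussInt]

/-- A complex Gaussian mean of `Ψ·0` vanishes. [cite: Balaban1988RG2Cluster, (2.14) p.15 (elementary property of the display)] -/
theorem cgaussMean_mul_zero {Λ : Type} [Fintype Λ] {_ : DecidableEq Λ} (A : Matrix Λ Λ ℂ) (Ψ : (Λ → ℝ) → ℂ) :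
    cgaussMean A (fun B => Ψ B * 0) = 0 := by
  simp [cgaussMean, cgaussInt]

/-- Lines 2–3 of (2.14) with the ZERO last line vanish. [cite: Balaban1988RG2Cluster, (2.14) p.15 (elementary property of the display)] -/
theorem integrand214_zero {Λ : Type} [Fintype Λ] {_ : DecidableEq Λ} {C : Type} [Fintype C] {_ : DecidableEq C} (A : Matrix Λ Λ ℂ)
    (Γ : (Λ ⊕ C → ℝ) → Λ → ℂ) (X : Λ ⊕ C → ℝ) : integrand214 A Γ (fun _ => 0) X = 0 := by
  simp [integrand214, cgaussMean_zero]

/-- The X-integral of (2.14) with the ZERO last line vanishes, for all parameters. [cite: Balaban1988RG2Cluster, (2.14) p.15 (elementary property of the display)] -/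
theorem core214_zero {Λ : Type} [Fintype Λ] {_ : DecidableEq Λ} {C : Type} [Fintype C] {_ : DecidableEq C} {ι : Type*} {D : Type*}
    (A : (ι → ℂ) → Matrix Λ Λ ℂ) (Γ : (ι → ℂ) → (Λ ⊕ C → ℝ) → Λ → ℂ) (σ : ι → ℂ) (τ : D → ℂ) :
    core214 A Γ (fun _ _ => 0) σ τ = 0 := by
  simp only [core214, integrand214_zero, cgaussMean_zero]

variable {θ : Stage3Params} (lamK : ResidB13K θ)

/-- **THE RELOCATED LEVER**: a row bond lying BOTH among the small-field bonds of Y₀ AND in P makes χ_{k,Y₀}(B)·χᶜ_{k,P}(B) vanish IDENTICALLY in B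
(print: `P ⊂ Y₀ᶜ*` in (2.3), so this never happens there — a LAW the data `Y0l`, `Pl` does NOT carry). [cite: Balaban1988RG2Cluster, (2.3) p.12] -/
theorem ResidB13K.chiY₀_mul_chicP_eq_zero {Z : TDom 4 (lamK.n + 1)} {t : B13TermIdx θ lamK.n lamK.m₃} {b : (lamK.𝒦 Z t).Λ}
    (hY : b ∈ lamK.Y0l Z t) (hP : b ∈ lamK.Pl Z t) (B : (lamK.𝒦 Z t).Λ → ℝ) : lamK.chiY₀ Z t B * lamK.chicP Z t B = 0 := by
  by_cases h : |B b| < lamK.rP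
  · have : lamK.chicP Z t B = 0 := Finset.prod_eq_zero hP (if_neg (not_le.2 h))
    rw [this, mul_zero]
  · have : lamK.chiY₀ Z t B = 0 := Finset.prod_eq_zero hY (if_neg h)
    rw [this, zero_mul]

/-- … hence the last line of (2.14) vanishes identically. [cite: Balaban1988RG2Cluster, (2.14) p.15 and (2.3) p.12] -/
theorem ResidB13K.F214_eq_zero_of_mem {Z : TDom 4 (lamK.n + 1)} {t : B13TermIdx θ lamK.n lamK.m₃} {b : (lamK.𝒦 Z t).Λ}
    (hY : b ∈ lamK.Y0l Z t) (hP : b ∈ lamK.Pl Z t) (φ : lamK.Φ) (τ : TDom 4 ((θ.ℓ₆ + 1) * (lamK.n + 1)) → ℂ)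
    (B : (lamK.𝒦 Z t).Λ → ℝ) : F214 t.2.card (lamK.chiY₀ Z t) (lamK.chicP Z t) t.1 (lamK.Vr Z t φ) τ B = 0 := by
  have h := lamK.chiY₀_mul_chicP_eq_zero hY hP B
  have h' : (lamK.chiY₀ Z t B : ℂ) * (lamK.chicP Z t B : ℂ) = 0 := by exact_mod_cast h
  unfold F214
  rw [mul_assoc ((-1 : ℂ) ^ t.2.card), h', mul_zero, zero_mul]

/-- … hence the X-integral Ψ(σ, τ) of the term vanishes for all parameters. [cite: Balaban1988RG2Cluster, (2.14) p.15 and (2.3) p.12] -/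
theorem ResidB13K.core_eq_zero_of_mem {Z : TDom 4 (lamK.n + 1)} {t : B13TermIdx θ lamK.n lamK.m₃} {b : (lamK.𝒦 Z t).Λ}
    (hY : b ∈ lamK.Y0l Z t) (hP : b ∈ lamK.Pl Z t) (φ : lamK.Φ) : lamK.core Z t φ = fun _ _ => 0 := by
  have hF : F214 t.2.card (lamK.chiY₀ Z t) (lamK.chicP Z t) t.1 (lamK.Vr Z t φ) = fun _ _ => 0 :=
    funext fun τ => funext fun B => lamK.F214_eq_zero_of_mem hY hP φ τ B
  refine funext fun σ => funext fun τ => ?_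
  show lamK.core Z t φ σ τ = 0
  rw [ResidB13K.core, hF]
  exact core214_zero _ _ σ τ

open Classical in
/-- **THE TERM OF RECORD VANISHES** at kernel data with a P-bond among the Y₀-bonds (whatever the kernels, the frame, r). [cite: Balaban1988RG2Cluster, (2.14) p.15 and (2.3) p.12] -/
theorem ResidB13K.T₃_eq_zero_of_mem {Z : TDom 4 (lamK.n + 1)} {t : B13TermIdx θ lamK.n lamK.m₃} {b : (lamK.𝒦 Z t).Λ}
    (hY : b ∈ lamK.Y0l Z t) (hP : b ∈ lamK.Pl Z t) (φ : lamK.Φ) : lamK.T₃ Z t φ = 0 := by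
  unfold ResidB13K.T₃
  rw [lamK.core_eq_zero_of_mem hY hP φ]
  exact term214_apply_zero _ _ _ _ _

open Classical in
/-- **HONESTY — THE ZERO-TOWER SPECIES ONE STOREY DOWN**: if every term `(𝐃, P)` of `Z` has a P-bond among its Y₀-bonds, the H OF RECORD of `Z` VANISHES
identically, whatever NODE A's kernels are — so an ∃-claim over `ResidB13K` with content must read the located laws of the χ-bond sets (print's `P ⊂ Y₀ᶜ*`,
`|Pl| = |P|`) and the kernels OF RECORD; g0's `exists_residB13_b13LeafOfRecord` (LOCATED-N10-ZEROTOWER) re-appears through `Y0l ∩ Pl ≠ ∅`.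
[cite: Balaban1988RG2Cluster, (2.9) p.14, (2.14) p.15, (2.3) p.12] -/
theorem ResidB13K.H_layer_eq_zero_of_forall_exists_mem (Z : TDom 4 (lamK.n + 1))
    (h : ∀ t ∈ terms (θ.ℓ₆ + 1) (lamK.m₃ + 1) Z, ∃ b, b ∈ lamK.Y0l Z t ∧ b ∈ lamK.Pl Z t) (φ : lamK.Φ) : lamK.layer.H Z φ = 0 := by
  rw [ResidB13K.H_layer]
  refine Finset.sum_eq_zero fun t ht => ?_
  obtain ⟨b, hY, hP⟩ := h t ht
  exact lamK.T₃_eq_zero_of_mem hY hP φ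

/-- **Such kernel data EXIST over every g0 layer**: attach the FREE kernels of `B13TermWalkDataOneTorus` on ONE row bond (`Λ := Unit`, no extra columns, the
one-point site torus), declare that bond both a Y₀-bond and a P-bond, embed trivially — then the H of record vanishes at every `Z`, `φ`.  (Non-vacuity of §3's
lever; the frame — spaces, (1.33) ∕ (1.41) data, letters — is the given layer's.) [cite: Balaban1988RG2Cluster, (2.14) p.15 and (2.3) p.12 (degenerate data)] -/
theorem exists_residB13K_H_layer_eq_zero (lam : ResidB13 θ) :
    ∃ lamK : ResidB13K θ, lamK.frame = { lam with T₃ := fun _ _ _ => 0 } ∧ ∀ Z φ, lamK.layer.H Z φ = 0 := by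
  classical
  let z : UT (![] : Fin 0 → ℕ) := B5TorusCover.UT.ofSite (N := (![] : Fin 0 → ℕ)) fun i => i.elim0
  haveI : ∀ i : Fin 0, NeZero ((![] : Fin 0 → ℕ) i) := fun i => i.elim0
  refine ⟨lam.withKernels 0 ![] ℂ (fun _ _ => freeKernels _ ℂ Unit Empty (fun _ => z) (fun _ => z))
    (finC := fun _ _ => inferInstanceAs (Fintype Empty)) (decC := fun _ _ => inferInstanceAs (DecidableEq Empty))
    (fun _ _ _ => 0) 1 (fun _ _ => Finset.univ) (fun _ _ => Finset.univ) (fun _ _ φ _ => φ), rfl, fun Z φ => ?_⟩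
  exact ResidB13K.H_layer_eq_zero_of_forall_exists_mem _ Z (fun t _ => ⟨(), Finset.mem_univ _, Finset.mem_univ _⟩) φ

variable (θ) in
/-- The kernel-keyed layer type is inhabited (over g0's `nonempty_residB13`). [cite: Balaban1988RG2Cluster, (2.14) p.15 (bookkeeping: the layer type is inhabited)] -/
theorem nonempty_residB13K : Nonempty (ResidB13K θ) := by
  obtain ⟨lam⟩ := nonempty_residB13 θ
  obtain ⟨lamK, -, -⟩ := exists_residB13K_H_layer_eq_zero lam
  exact ⟨lamK⟩

variable (θ) in
/-- The kernel-keyed family type is inhabited. [cite: Balaban1988RG2Cluster, (2.14) p.15 (bookkeeping)] -/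
theorem nonempty_residB13KFam : Nonempty (ResidB13KFam θ) := by
  obtain ⟨lamK⟩ := nonempty_residB13K θ
  exact ⟨fun _ _ => lamK⟩

end Honesty

end Literature.MathematicalPhysics.QuantumFieldTheory.Balaban1983to89.Node00

end
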